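import Mathlib
import Summits.Ventures.DiscreteObjects.Mahler.SchinzelTotallyReal

/-!
# Existence of Graeffe iterates in `ℤ[X]` (venture `DiscreteObjects`, target L)

Cell `pub-namedobj`, seat `pub-namedobj-mahler` (gen 8). Framing: lottery ticket; floor = certified
bounds/negative ranges.

The census vocabulary (`SmallMeasureCensus.IsGraeffeIterate`, `GraeffeIdentity.GraeffeChain`) names the
Graeffe root-squaring relation `q(x²) = ± p(x) p(-x)` used by the engines' rejection certificates.  Here
we prove that iterates EXIST: every monic `p ∈ ℤ[X]` has a Graeffe iterate (`exists_isGraeffeIterate`,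
from `SchinzelTotallyReal.exists_graeffe`: `P(x)P(-x)` is even, `= Q(x²)` with `Q = contract 2 (P·P(-x))`),
and hence Graeffe chains of every length (`exists_graeffeChain`), along which `M(p_m) = M(p)^{2^m}`
(`GraeffeIdentity.intMahlerMeasure_of_graeffeChain`).
-/

namespace Summit.Ventures.DiscreteObjects.Mahler

open Polynomial

/-- **Every monic integer polynomial has a Graeffe iterate**: a monic `q` of the same degree with
`q(x²) = ± p(x) p(-x)`. -/
theorem exists_isGraeffeIterate {p : ℤ[X]} (hp : p.Monic) : ∃ q : ℤ[X], IsGraeffeIterate p q := by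
  obtain ⟨Q, hQ⟩ := exists_graeffe p
  have hnegX : (-X : ℤ[X]).natDegree = 1 := by rw [natDegree_neg, natDegree_X]
  have hlcneg : (-X : ℤ[X]).leadingCoeff = -1 := by rw [leadingCoeff_neg, leadingCoeff_X]
  have hpc : (p.comp (-X)).leadingCoeff = (-1) ^ p.natDegree := by
    rw [leadingCoeff_comp (by rw [hnegX]; norm_num), hp.leadingCoeff, one_mul, hlcneg]
  have hpc0 : p.comp (-X) ≠ 0 := by
    intro h
    rw [h, leadingCoeff_zero] at hpc
    exact (pow_ne_zero _ (by norm_num : (-1 : ℤ) ≠ 0)) hpc.symm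
  have hprod_lc : (p * p.comp (-X)).leadingCoeff = (-1) ^ p.natDegree := by
    rw [leadingCoeff_mul, hp.leadingCoeff, one_mul, hpc]
  have hprod_deg : (p * p.comp (-X)).natDegree = 2 * p.natDegree := by
    rw [natDegree_mul hp.ne_zero hpc0, natDegree_comp, hnegX]; ring
  have hX2 : (X ^ 2 : ℤ[X]).natDegree = 2 := natDegree_X_pow 2
  have hQdeg : Q.natDegree = p.natDegree := by
    have h := congrArg natDegree hQ
    rw [natDegree_comp, hX2, hprod_deg] at h
    omega
  have hQlc : Q.leadingCoeff = (-1) ^ p.natDegree := by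
    have h := congrArg leadingCoeff hQ
    rw [leadingCoeff_comp (by rw [hX2]; norm_num), leadingCoeff_X_pow, one_pow, mul_one, hprod_lc] at h
    exact h
  rcases Nat.even_or_odd p.natDegree with hev | hodd
  · refine ⟨Q, ?_, hQdeg, Or.inl hQ⟩
    rw [Monic, hQlc, hev.neg_one_pow]
  · refine ⟨-Q, ?_, by rw [natDegree_neg, hQdeg], Or.inr ?_⟩
    · rw [Monic, leadingCoeff_neg, hQlc, hodd.neg_one_pow, neg_neg]
    · rw [neg_comp, hQ]

/-- Graeffe chains of every length exist from a monic start. -/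
theorem exists_graeffeChain {p : ℤ[X]} (hp : p.Monic) (m : ℕ) :
    ∃ q : ℤ[X], q.Monic ∧ GraeffeChain p m q := by
  induction m with
  | zero => exact ⟨p, hp, GraeffeChain.refl p⟩
  | succ m ih =>
    obtain ⟨q, hq, hc⟩ := ih
    obtain ⟨r, hr⟩ := exists_isGraeffeIterate hq
    exact ⟨r, hr.1, GraeffeChain.step hc hr⟩

/-- Consequently, for monic `p` and every `m` there is a monic `q` of the same degree with
`M(q) = M(p)^{2^m}` (the quantity the census engines bound coefficientwise). -/
theorem exists_monic_intMahlerMeasure_eq_pow {p : ℤ[X]} (hp : p.Monic) (m : ℕ) :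
    ∃ q : ℤ[X], q.Monic ∧ q.natDegree = p.natDegree ∧ intMahlerMeasure q = intMahlerMeasure p ^ (2 ^ m) := by
  induction m with
  | zero => exact ⟨p, hp, rfl, by simp⟩
  | succ m ih =>
    obtain ⟨q, hq, hdeg, hM⟩ := ih
    obtain ⟨r, hr⟩ := exists_isGraeffeIterate hq
    refine ⟨r, hr.1, hr.2.1.trans hdeg, ?_⟩
    rw [intMahlerMeasure_sq_of_isGraeffeIterate hr, hM, ← pow_mul, pow_succ]

end Summit.Ventures.DiscreteObjects.Mahler
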